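import Summits.QuantumAdvantage.QuantumAdvantage.Theorems.NearExactIsExact.Negative.ProductTest
import Summits.QuantumAdvantage.QuantumAdvantage.Theorems.NearExactIsExact.Negative.ProjectionConcat

/-!
# `NearExactIsExact` (stmt-QuantumAdvantage-14043) — negative-side tools for frame-preserving ("triangular")
  biquadratic configurations: ISOLATING FLATS (Bose–Burton over `𝔽₂`, chart-valued) and constant SLICE PARITY

Setting (b2b cell, DISPROOF §45 — THEOREM BQQ^tri₃ / PC6♯): `π, τ` mutually inverse coordinatewise-quadratic maps of
`𝔽₂^{k+3}` with `π` preserving the first `k` coordinates (the "frame" `t`; the last three form the nonlinear block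
`y`), `c₁, c₂` cubic, residual `R = c₁ ⊕ c₂∘π` with slices `R_t = R(t ‖ ·)` on `𝔽₂³`.
* `exists_affine_isolating`: if `|N|·2^j < 2^{k+1}` then through every `t` passes an affinely parametrised
  (possibly degenerate) `j`-flat `φ : 𝔽₂^j → 𝔽₂^k`, `φ 0 = t`, with `φ s ∉ N` for all `s ≠ 0` — the greedy
  `q = 2` case of the Bose–Burton bound, in the chart form consumed by the restriction lemma
  (`TriangularBqq.window_of_bqq`).
* `card_xor_add`, `slice_pair_even`, `slice_weights_even`: all residual slices `R_t` have the same parity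
  (`|R_t| ≡ |c₁(t‖·)| + |c₂(t‖·)|` since `y ↦ π_t y` is a bijection, and two slices of one cubic form a cubic on a
  4-flat, which has even weight).
HONEST FRAMING: helper lemmas on the NEGATIVE side of the crux (inputs of `TriangularBqq.bqq_triangular`); no Theses
statement is asserted; standard axioms; NOT summit progress.
-/

set_option linter.dupNamespace false -- D-0017: single-problem summit ⇒ `QuantumAdvantage.QuantumAdvantage` by design

namespace Summit.QuantumAdvantage.QuantumAdvantage.Theorems.NearExactIsExact.Negative.IsolatingFlat

open Finset
open Literature.Computability.QuantumComplexity
open Summit.QuantumAdvantage.QuantumAdvantage.Theorems.CubicForrelation.NearExactIsExact (fc_deg_bxor fc_isDegLeFun_comp)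
open Summit.QuantumAdvantage.QuantumAdvantage.Theorems.NearExactIsExact.Negative.ProductTest (even_card_of_deg_lt)
open Summit.QuantumAdvantage.QuantumAdvantage.Theorems.NearExactIsExact.Negative.ProjectionConcat (card_filter_append)

variable {k : ℕ}

/-! ### Isolating flats (Bose–Burton over `𝔽₂`, greedy and chart-valued) -/

/-- **Isolating flat.** If `|N|·2^j < 2^{k+1}` then through any `t` there is an affinely parametrised `j`-flat
`φ : 𝔽₂^j → 𝔽₂^k` (`φ 0 = t`, coordinates affine in `s`; possibly degenerate) all of whose points `φ s`, `s ≠ 0`,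
avoid `N`.  Greedy: the `(i+1)`-st direction must avoid the `< 2^k` translates `φ_i(s') ⊕ n`, `n ∈ N`.
[cite: BoseBurton1966, Thm. 1 (case q = 2)] -/
theorem exists_affine_isolating (N : Finset (Fin k → Bool)) (t : Fin k → Bool) :
    ∀ j : ℕ, #N * 2 ^ j < 2 ^ (k + 1) →
      ∃ φ : (Fin j → Bool) → (Fin k → Bool), (∀ x, IsDegLeFun 1 (fun s => φ s x)) ∧
        φ (fun _ => false) = t ∧ ∀ s, s ≠ (fun _ => false) → φ s ∉ N
  | 0, _ => ⟨fun _ => t, fun x => isDegLeFun_const 1 (t x), rfl, fun s hs => absurd (funext fun i => i.elim0) hs⟩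
  | j + 1, hj => by
    classical
    have hj' : 2 ^ j * #N < 2 ^ k := by
      have h2 : 2 ^ j * #N * 2 < 2 ^ k * 2 := by
        calc 2 ^ j * #N * 2 = #N * 2 ^ (j + 1) := by ring
          _ < 2 ^ (k + 1) := hj
          _ = 2 ^ k * 2 := pow_succ 2 k
      exact Nat.lt_of_mul_lt_mul_right h2
    obtain ⟨φ, hφ, hφ0, hφN⟩ := exists_affine_isolating N t j
      (lt_of_le_of_lt (Nat.mul_le_mul_left _ (Nat.pow_le_pow_right (by norm_num) (Nat.le_succ j))) hj)
    -- the forbidden directions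
    set B : Finset (Fin k → Bool) :=
      (univ ×ˢ N).image (fun p : (Fin j → Bool) × (Fin k → Bool) => fun x => φ p.1 x ^^ p.2 x) with hB
    have hBcard : #B < #(univ : Finset (Fin k → Bool)) := by
      calc #B ≤ #(univ ×ˢ N) := card_image_le
        _ = 2 ^ j * #N := by rw [card_product, card_univ, Fintype.card_fun, Fintype.card_bool, Fintype.card_fin]
        _ < 2 ^ k := hj'
        _ = #(univ : Finset (Fin k → Bool)) := by
          rw [card_univ, Fintype.card_fun, Fintype.card_bool, Fintype.card_fin]
    obtain ⟨v, hv⟩ : ∃ v : Fin k → Bool, v ∉ B := by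
      by_contra h
      push Not at h
      exact absurd (card_le_card (fun v _ => h v : (univ : Finset (Fin k → Bool)) ⊆ B)) (not_le.2 hBcard)
    refine ⟨fun s x => φ (Fin.tail s) x ^^ (s 0 && v x), fun x => ?_, ?_, fun s hs => ?_⟩
    · refine fc_deg_bxor ?_ ?_
      · exact fc_isDegLeFun_comp (hφ x) (fun (s : Fin (j + 1) → Bool) => Fin.tail s)
          (fun i => isDegLeFun_apply (Fin.succ i) le_rfl) le_rfl
      · cases v x
        · simp only [Bool.and_false]; exact isDegLeFun_const 1 false
        · simp only [Bool.and_true]; exact isDegLeFun_apply (0 : Fin (j + 1)) le_rfl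
    · funext x
      change (φ (fun _ => false) x ^^ (false && v x)) = t x
      rw [hφ0, Bool.false_and, Bool.xor_false]
    · cases h0 : s 0
      · have htail : Fin.tail s ≠ fun _ => false := by
          intro h
          apply hs
          funext i
          refine Fin.cases ?_ (fun i' => ?_) i
          · exact h0
          · exact congrFun h i'
        have e : (fun x => φ (Fin.tail s) x ^^ (s 0 && v x)) = φ (Fin.tail s) := by
          funext x; rw [h0, Bool.false_and, Bool.xor_false]
        show (fun x => φ (Fin.tail s) x ^^ (s 0 && v x)) ∉ N
        rw [e]
        exact hφN _ htail
      · show (fun x => φ (Fin.tail s) x ^^ (s 0 && v x)) ∉ N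
        intro hmem
        apply hv
        rw [hB, mem_image]
        refine ⟨(Fin.tail s, fun x => φ (Fin.tail s) x ^^ (s 0 && v x)), mem_product.2 ⟨mem_univ _, hmem⟩, ?_⟩
        funext x
        have hxx : ∀ a b : Bool, (a ^^ (a ^^ (true && b))) = b := by decide
        simp only [h0, hxx]

/-! ### Slice parities -/

/-- `#{P ⊕ Q} + 2·#{P ∧ Q} = #{P} + #{Q}`. -/
theorem card_xor_add {α : Type*} [Fintype α] (P Q : α → Bool) :
    #(univ.filter fun x => (P x ^^ Q x) = true) + 2 * #(univ.filter fun x => (P x && Q x) = true) =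
      #(univ.filter fun x => P x = true) + #(univ.filter fun x => Q x = true) := by
  rw [card_filter, card_filter, card_filter, card_filter, mul_sum, ← sum_add_distrib, ← sum_add_distrib]
  refine sum_congr rfl fun x _ => ?_
  cases P x <;> cases Q x <;> simp

/-- Two slices `y ↦ c(t ‖ y)`, `y ↦ c(t' ‖ y)` of a cubic on `𝔽₂^{k+3}` have weights of the same parity
(the pair is a cubic on the 4-flat `{t, t'} × 𝔽₂³`, `3 < 4`). -/
theorem slice_pair_even (c : (Fin (k + 3) → Bool) → Bool) (hc : IsDegLeFun 3 c) (t t' : Fin k → Bool) :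
    Even (#(univ.filter fun y : Fin 3 → Bool => c (Fin.append t y) = true) +
      #(univ.filter fun y : Fin 3 → Bool => c (Fin.append t' y) = true)) := by
  classical
  set G : (Fin (1 + 3) → Bool) → Bool := fun z =>
    c (Fin.append (fun x => t x ^^ (z (Fin.castAdd 3 0) && (t x ^^ t' x))) (fun i => z (Fin.natAdd 1 i))) with hG
  have hGdeg : IsDegLeFun 3 G := by
    refine fc_isDegLeFun_comp hc (fun z : Fin (1 + 3) → Bool =>
      Fin.append (fun x => t x ^^ (z (Fin.castAdd 3 0) && (t x ^^ t' x))) (fun i => z (Fin.natAdd 1 i)))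
      (fun v => ?_) (show 1 * 3 ≤ 3 by norm_num)
    induction v using Fin.addCases with
    | left x =>
      simp only [Fin.append_left]
      refine fc_deg_bxor (isDegLeFun_const 1 (t x)) ?_
      cases (t x ^^ t' x)
      · simp only [Bool.and_false]; exact isDegLeFun_const 1 false
      · simp only [Bool.and_true]; exact isDegLeFun_apply _ le_rfl
    | right i =>
      simp only [Fin.append_right]
      exact isDegLeFun_apply _ le_rfl
  have hEven := even_card_of_deg_lt hGdeg (by norm_num : 3 < 1 + 3)
  rw [card_filter_append] at hEven
  have huniv : (univ : Finset (Fin 1 → Bool)) = {(fun _ => false), (fun _ => true)} := by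
    ext b
    simp only [mem_univ, mem_insert, mem_singleton, true_iff]
    cases hb : b 0
    · exact Or.inl (funext fun i => by rw [Subsingleton.elim i 0]; exact hb)
    · exact Or.inr (funext fun i => by rw [Subsingleton.elim i 0]; exact hb)
  have hne : (fun _ : Fin 1 => false) ≠ (fun _ => true) := fun h => Bool.false_ne_true (congrFun h 0)
  rw [huniv, sum_pair hne] at hEven
  have hxx : ∀ a b : Bool, (a ^^ (true && (a ^^ b))) = b := by decide
  have e0 : ∀ y : Fin 3 → Bool, G (Fin.append (fun _ => false) y) = c (Fin.append t y) := by
    intro y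
    simp only [hG, Fin.append_left, Fin.append_right, Bool.false_and, Bool.xor_false]
  have e1 : ∀ y : Fin 3 → Bool, G (Fin.append (fun _ => true) y) = c (Fin.append t' y) := by
    intro y
    simp only [hG, Fin.append_left, Fin.append_right, hxx]
  simp only [e0, e1] at hEven
  exact hEven

/-- **Slice parity is constant.** For a frame-preserving biquadratic configuration, the residual slices
`R_t = (c₁ ⊕ c₂∘π)(t ‖ ·)` all have the same parity: `|R_t| ≡ |c₁(t‖·)| + |c₂(t‖·)| (mod 2)` because
`y ↦ π_t(y)` is a bijection of `𝔽₂³`, and each summand has constant parity by `slice_pair_even`. -/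
theorem slice_weights_even (π τ : (Fin (k + 3) → Bool) → (Fin (k + 3) → Bool))
    (hτπ : ∀ z, τ (π z) = z) (hpres : ∀ z (i : Fin k), π z (Fin.castAdd 3 i) = z (Fin.castAdd 3 i))
    (c₁ c₂ : (Fin (k + 3) → Bool) → Bool) (h₁ : IsDegLeFun 3 c₁) (h₂ : IsDegLeFun 3 c₂) (t t' : Fin k → Bool) :
    Even (#(univ.filter fun y : Fin 3 → Bool => (c₁ (Fin.append t y) ^^ c₂ (π (Fin.append t y))) = true) +
      #(univ.filter fun y : Fin 3 → Bool => (c₁ (Fin.append t' y) ^^ c₂ (π (Fin.append t' y))) = true)) := by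
  classical
  -- the slice maps `σ_u(y) = y-part of π(u ‖ y)` are bijections and `π(u ‖ y) = (u ‖ σ_u y)`
  have hsplit : ∀ (u : Fin k → Bool) (y : Fin 3 → Bool),
      π (Fin.append u y) = Fin.append u (fun i => π (Fin.append u y) (Fin.natAdd k i)) := by
    intro u y
    funext v
    induction v using Fin.addCases with
    | left x => rw [Fin.append_left, hpres, Fin.append_left]
    | right i => rw [Fin.append_right]
  have hbij : ∀ u : Fin k → Bool,
      Function.Bijective (fun y : Fin 3 → Bool => fun i => π (Fin.append u y) (Fin.natAdd k i)) := by
    intro u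
    refine Finite.injective_iff_bijective.1 fun y₁ y₂ hy => ?_
    have e : Fin.append u y₁ = Fin.append u y₂ := by
      rw [← hτπ (Fin.append u y₁), ← hτπ (Fin.append u y₂), hsplit u y₁, hsplit u y₂]
      exact congrArg τ (congrArg (Fin.append u) hy)
    funext i
    have := congrFun e (Fin.natAdd k i)
    rwa [Fin.append_right, Fin.append_right] at this
  have hQ : ∀ u : Fin k → Bool, #(univ.filter fun y : Fin 3 → Bool => c₂ (π (Fin.append u y)) = true) =
      #(univ.filter fun y : Fin 3 → Bool => c₂ (Fin.append u y) = true) := by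
    intro u
    have e : (univ.filter fun y : Fin 3 → Bool => c₂ (π (Fin.append u y)) = true) =
        univ.filter fun y => (fun y' => c₂ (Fin.append u y'))
          ((fun y : Fin 3 → Bool => fun i => π (Fin.append u y) (Fin.natAdd k i)) y) = true :=
      filter_congr fun y _ => by
        simp only
        rw [← hsplit u y]
    rw [e]
    exact Summit.QuantumAdvantage.QuantumAdvantage.Theorems.NearExactIsExact.Negative.BqqSeven.bq_card_filter_comp
      (fun y : Fin 3 → Bool => fun i => π (Fin.append u y) (Fin.natAdd k i)) (hbij u) (fun y' => c₂ (Fin.append u y'))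
  have k1 := card_xor_add (fun y : Fin 3 → Bool => c₁ (Fin.append t y)) (fun y => c₂ (π (Fin.append t y)))
  have k2 := card_xor_add (fun y : Fin 3 → Bool => c₁ (Fin.append t' y)) (fun y => c₂ (π (Fin.append t' y)))
  rw [hQ t] at k1
  rw [hQ t'] at k2
  obtain ⟨a, ha⟩ := slice_pair_even c₁ h₁ t t'
  obtain ⟨b, hb⟩ := slice_pair_even c₂ h₂ t t'
  refine ⟨a + b - #(univ.filter fun y : Fin 3 → Bool => (c₁ (Fin.append t y) && c₂ (π (Fin.append t y))) = true) -
    #(univ.filter fun y : Fin 3 → Bool => (c₁ (Fin.append t' y) && c₂ (π (Fin.append t' y))) = true), ?_⟩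
  omega

end Summit.QuantumAdvantage.QuantumAdvantage.Theorems.NearExactIsExact.Negative.IsolatingFlat
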